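import Summits.MatrixMultiplication.MatrixMultiplication.Theorems.AbelianSTPPCensusTAKnap473Sound
import Summits.MatrixMultiplication.MatrixMultiplication.Theorems.AbelianSTPPCensusTAKnap473EvalA
import Summits.MatrixMultiplication.MatrixMultiplication.Theorems.AbelianSTPPCensusTAKnap473EvalB
import Summits.MatrixMultiplication.MatrixMultiplication.Theorems.AbelianSTPPCensusTAKnap473EvalC
import Summits.MatrixMultiplication.MatrixMultiplication.Theorems.AbelianSTPPCensusTAKnap473EvalD
import Summits.MatrixMultiplication.MatrixMultiplication.Theorems.AbelianSTPPCensusLeafTA450Closed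

/-!
# Rung leaf T_A/473 closed: no abelian STPP host of order `≤ 473` beats `τ = 2.371`

Cell mm-stpp (rung F-M1, D-0059/D-0061), OPTIONAL alt-closer rung leaf `NoAbelianSTPPHost_2371_473` (`AbelianSTPPCensusTargets.lean`;
planner registration 2026-08-26T17:58:38Z, director-frontier GO-OPTIONAL 20:04:18Z): for every finite abelian group `H` with `|H| ≤ 473` and
every STPP family `(A_i,B_i,C_i)` in `H`, `Σ_i (|A_i||B_i||C_i|)^{2.371/3} ≤ |H|`.  `473` is the exact range of the method: at `474` the vM
shape instrument admits the beating class `(6,6,7)², (6,7,6)², (7,6,6)²` (`TAKnap.vmCensusTA_false_at_474`, `AbelianSTPPCensusTASharp474.lean`).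
Assembly:
* `|H| ≤ 450`: the landed leaf `noAbelianSTPPHost_2371_450` (`AbelianSTPPCensusLeafTA450Closed.lean`, p465173);
* `451 ≤ |H| ≤ 473`: degenerate and one-member families by `AbelianTECensus.noAbelianSTPPHostUpTo_of_two`; otherwise vM soundness
  `AbelianTECensus.sieveSound` (`IsSTPP ⇒ SieveAdmissible`) and the knapsack certificate at universe `473` — `TAKnap473.checked_all`
  chains the five kernel segments `TAKnap473.seg1 … seg5` through `TAKnap473.seg_sound`, and `TAKnap473.not_beats_of_checked` turns them
  into `¬ Beats (2371/1000) M`.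
WHAT THIS IS NOT: no bound on `ω` (a rung leaf, never summit credit); nothing about orders `≥ 474`; nothing about the alive `5/2` lists
of the census (`338`, primes `521/523`, …).
-/

set_option linter.dupNamespace false
set_option autoImplicit false

namespace Summit.MatrixMultiplication.MatrixMultiplication.Theorems

namespace TAKnap473

/-! ## All volumes are checked for the orders `451 … 473` (chaining the five kernel segments) -/

/-- Every volume `1 … 473` is `Checked` for the orders `451, …, 473` (`451 + 23 = 474`): the segment evaluations
`seg1 … seg5` chained through `seg_sound` from `inv_row0`. [original] -/
theorem checked_all : ∀ V, 1 ≤ V → V ≤ Mtop → Checked 451 23 V := by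
  have s1 := seg_sound (lo := 451) (n := 23) (by norm_num) (by simpa using inv_row0) seg1
  have s2 := seg_sound (by norm_num) (by simpa using s1.1) seg2
  have s3 := seg_sound (by norm_num) (by simpa using s2.1) seg3
  have s4 := seg_sound (by norm_num) (by simpa using s3.1) seg4
  have s5 := loopVR_sound 451 23 143 331 row330 (by norm_num) (by simpa using s4.1) seg5
  intro V h1 h2
  simp only [Mtop] at h2
  rcases Nat.lt_or_ge V 29 with h | h
  · exact s1.2 V h1 (by omega)
  rcases Nat.lt_or_ge V 91 with h' | h'
  · exact s2.2 V h (by omega)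
  rcases Nat.lt_or_ge V 231 with h'' | h''
  · exact s3.2 V h' (by omega)
  rcases Nat.lt_or_ge V 331 with h''' | h'''
  · exact s4.2 V h'' (by omega)
  · exact s5.2 V h''' (by omega)

/-- **T_A arithmetic exclusion, orders `451 … 473`.** No `SieveAdmissible` shape list with at least two members beats
`τ = 2371/1000` at an order `451 ≤ M ≤ 473`. [original] -/
theorem not_beats_2371 (N M : ℕ) (a b c : Fin N → ℕ) (hN : 2 ≤ N) (h1 : 451 ≤ M) (h2 : M ≤ 473)
    (hS : SieveAdmissible M a b c) : ¬ Beats (2371 / 1000) M a b c :=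
  not_beats_of_checked checked_all hN h1 (by omega) (by simpa [Mtop] using h2) hS

end TAKnap473

/-- **Rung leaf T_A/473 (closed; OPTIONAL alt-closer).** No abelian STPP host of order `≤ 473` beats the record exponent `2.371`:
`Σ_i (|A_i||B_i||C_i|)^{2.371/3} ≤ |H|` for every STPP family in every finite abelian group `H` with `|H| ≤ 473` — no such family
certifies `ω < 2.371` through the Cohn–Umans/CKSU packing bound.  Orders `≤ 450`: `noAbelianSTPPHost_2371_450` (T_A/450); orders
`451 … 473`: vM soundness `AbelianTECensus.sieveSound` + the knapsack certificate `TAKnap473.not_beats_2371`; degenerate / one-member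
families: `AbelianTECensus.noAbelianSTPPHostUpTo_of_two`.  `473` is the exact range of the vM method at `τ = 2.371`
(`TAKnap.vmCensusTA_false_at_474`).
WHAT THIS IS NOT: no bound on `ω`; a rung leaf (never summit credit); nothing about orders `≥ 474` or about the alive `5/2` lists.
[original] -/
theorem noAbelianSTPPHost_2371_473 : NoAbelianSTPPHost_2371_473 := by
  classical
  unfold NoAbelianSTPPHost_2371_473
  refine AbelianTECensus.noAbelianSTPPHostUpTo_of_two (τ := 2371 / 1000) (by norm_num) (by norm_num) ?_
  intro H _ _ hM N A B C hS hne hN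
  by_cases h450 : Fintype.card H ≤ 450
  · exact noAbelianSTPPHost_2371_450 H h450 N A B C hS
  · have hadm := AbelianTECensus.sieveSound H N A B C hS hne
    have h := TAKnap473.not_beats_2371 N (Fintype.card H) _ _ _ hN (by omega) hM hadm
    unfold Beats at h
    rw [not_lt] at h
    simpa [shapeVol] using h

end Summit.MatrixMultiplication.MatrixMultiplication.Theorems
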